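import Summits.NavierStokesRegularity.NavierStokesRegularity.Theorems.SelfMixingDichotomyCoherentScaleExclusionKinWitnessSmooth
import Summits.NavierStokesRegularity.NavierStokesRegularity.Theorems.SelfMixingDichotomyCoherentScaleExclusionKinWitnessDivFree
import Summits.NavierStokesRegularity.NavierStokesRegularity.Theorems.SelfMixingDichotomyCoherentScaleExclusionKinWitnessWindowBounds
import Summits.NavierStokesRegularity.NavierStokesRegularity.Theorems.SelfMixingDichotomyCoherentScaleExclusionSwirlCoherence
import Summits.NavierStokesRegularity.NavierStokesRegularity.Theorems.SelfMixingDichotomyCoherentScaleExclusionSelfSimilarSwirlPointwise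
import Summits.NavierStokesRegularity.NavierStokesRegularity.Theorems.SelfMixingDichotomyCoherentScaleExclusionSelfSimilarSwirlLoadFloor
import Summits.NavierStokesRegularity.NavierStokesRegularity.Theorems.SelfMixingDichotomyCoherentScaleExclusionSelfSimilarSwirlLoadCeiling
import Literature.Analysis.FluidPDE.DissipatesAtScale
import Literature.Analysis.FluidPDE.SuitableWeak
import HarnessLib

/-!
# Route SelfMixingDichotomy — crux `CoherentScaleExclusion` (S2, stmt-NavierStokesRegularity-1423), line `registered`,
# lead c3: the coherent Type-I stub (regime A) is NOT a kinematic fact — self-similar swirling eddies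

Support file (`--supports stmt-NavierStokesRegularity-1423`; registered sub-goal
`stub_coherentTypeIExclusion_false_without_momentum` of `Cruxes/CoherentScaleExclusion/Lines/birth.lean`).

The registered stub A `stub_coherentTypeIExclusion` of the birth line says: for `0 < δ < 1` there is a threshold
`M` such that, for every finite-energy classical Navier–Stokes solution and every `x₀`, a Type-I CEILING on the
load (`cknC r (T,x₀) u ≤ M₁` for small `r`) together with RECURRENT `δ`-coherent `M`-loaded scales
(`ofReal M ≤ cknC r ∧ ¬ MIX(r, δ)` for arbitrarily small `r`) forces boundedness near `(T, x₀)`. In tree, A is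
implied by the sibling crux S1 and by `¬ TypeISingularityExists` (p146791, p150484) — statements about
Navier–Stokes. THIS FILE shows that A with the Navier–Stokes class replaced by the KINEMATIC class (smooth
space–time field on `[0,T) × ℝ³`, divergence free, uniformly bounded energy, `L∞` Type-I for some constant) is
FALSE, so A — like the cascade stub B (`stub_coherentCascadeExclusion_false_without_momentum`, p165625) — needs
the momentum equation. The point is the quantifier order `∀ δ ∃ M ∀ u`: a witness family must stay `δ`-coherent
for ONE `δ` while its load, hence its amplitude, exceeds every `M`; the drift-generic Type-I floor of lead c2
(`δ ≤ δ₁(K) → 0` as the Type-I constant `K → ∞`) cannot do this, the amplitude-free swirl coherence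
`stub_sphereTangential_notDissipatesAtScale` (file `…SwirlCoherence`) can.

THE WITNESS FAMILY (`T = 1`, `x₀ = 0`, amplitude `A = max 1 (M/κ)`): the exactly self-similar swirling eddy

  `uA t x = (A (1−t)⁻¹ expNegInvGlue (4 − ‖x‖²/(1−t))) • (−x₁, x₀, 0)`  for `t < 1`,  `0` after,

a solid-body-like core of radius `2√(1−t)` (the parabolic scale), speed `≤ 2A (1−t)^{−1/2}` (Type-I(2A)),
energy `≤ 32 A² |B₁|`, load `κ A³ ≤ C(r) ≤ M₁(A)` at EVERY scale (self-similarity: a Type-I ceiling AND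
`M`-loaded), tangential to the spheres about `0` hence `¬ MIX(r, δ)` at EVERY scale for `δ ≤ δ₁` whatever `A`,
and unbounded near `(1, 0)`.

## Contents
* `coherentTypeI_kinematicWitness` — the family packaged: for ONE `δ ∈ (0,1)` and EVERY `M`, a kinematic field
  with a `C`-ceiling, load `≥ M` and `¬ MIX(r, δ)` at every scale, unbounded at `(1,0)`; assembled from the
  registered sub-goals `stub_selfSimilarSwirl_pointwise` (support, Type-I, energy, unboundedness),
  `stub_selfSimilarSwirl_loadFloor` (`κ A³ ≤ C(r)`), `stub_selfSimilarSwirl_loadCeiling` (`C(r) ≤ M₁`),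
  `stub_sphereTangential_notDissipatesAtScale` (coherence), and the c2 lemmas `kinWitness_contDiffOn_swirlField`,
  `kinWitness_isDivFree_swirlField`, `kinWitness_windowBounds_of_spatialSupport`;
* `stub_coherentTypeIExclusion_false_without_momentum` (registered sub-goal).
-/

noncomputable section

open Literature.Analysis.FluidPDE MeasureTheory Set Function Metric
open scoped ContDiff InnerProductSpace

-- `Summit = Problem` for this summit; the tree lakefile sets `weak.linter.dupNamespace = false`.
set_option linter.dupNamespace false

namespace Summit.NavierStokesRegularity.NavierStokesRegularity.Theorems

/-- **The regime-A kinematic witness family.** There is `δ ∈ (0,1)` such that for EVERY threshold `M` there is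
a drift `u : ℝ → ℝ³ → ℝ³` — the self-similar swirling eddy `uA` of amplitude `A = max 1 (M/κ)` (module
docstring) — which is a smooth space–time field on `[0,1) × ℝ³`, divergence free at every time, of uniformly
bounded energy from time `0`, `L∞` Type-I(2A) before `t = 1`, whose CKN load at `(1,0)` is bounded above at every
scale (a Type-I CEILING in `C`) and bounded below by `M` at every scale, which is non-`δ`-mixing at EVERY scale
(tangential to the spheres about `0`: `stub_sphereTangential_notDissipatesAtScale`), and which is unbounded near
`(1, 0)`. -/
theorem coherentTypeI_kinematicWitness : ∃ δ : ℝ, 0 < δ ∧ δ < 1 ∧ ∀ M : ℝ,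
    ∃ u : ℝ → EuclideanSpace ℝ (Fin 3) → EuclideanSpace ℝ (Fin 3),
      IsSmoothSpaceTimeOn (Set.Ico 0 1) u ∧
      (∀ t : ℝ, VectorCalculus.IsDivFree (u t)) ∧
      (∃ E₀ : ℝ, ∀ t : ℝ, 0 ≤ t → MemLp (u t) 2 volume ∧ ∫ x, ‖u t x‖ ^ 2 ≤ E₀) ∧
      (∃ K : ℝ, ∀ t : ℝ, t < 1 → ∀ x : EuclideanSpace ℝ (Fin 3), Real.sqrt (1 - t) * ‖u t x‖ ≤ K) ∧
      (∃ M₁ : ℝ, ∀ r : ℝ, 0 < r →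
        cknC r (((1 : ℝ), (0 : EuclideanSpace ℝ (Fin 3))) : ℝ × EuclideanSpace ℝ (Fin 3)) u ≤
          ENNReal.ofReal M₁) ∧
      (∀ r : ℝ, 0 < r → ENNReal.ofReal M ≤
        cknC r (((1 : ℝ), (0 : EuclideanSpace ℝ (Fin 3))) : ℝ × EuclideanSpace ℝ (Fin 3)) u) ∧
      (∀ r : ℝ, 0 < r → ¬ DissipatesAtScale u 1 0 r δ) ∧
      (∀ ρ : ℝ, 0 < ρ → ∀ M' : ℝ, ∃ t ∈ Set.Ioo (1 - ρ ^ 2) 1,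
        ∃ x ∈ Metric.ball (0 : EuclideanSpace ℝ (Fin 3)) ρ, M' < ‖u t x‖) := by
  obtain ⟨δ₁, hδ₁, hSW⟩ := stub_sphereTangential_notDissipatesAtScale
  obtain ⟨κ, hκ, hfloor⟩ := stub_selfSimilarSwirl_loadFloor
  refine ⟨min δ₁ (1/2), lt_min hδ₁ (by norm_num), (min_le_right _ _).trans_lt (by norm_num), ?_⟩
  intro M
  -- the amplitude: `A = max 1 (M/κ)`, so that `κ A³ ≥ κ A ≥ M` and `A > 0`
  set A : ℝ := max 1 (M / κ) with hA
  have hA1 : 1 ≤ A := le_max_left _ _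
  have hA0 : 0 < A := one_pos.trans_le hA1
  have hκA : M ≤ κ * A ^ 3 := by
    have h1 : M / κ ≤ A := le_max_right _ _
    have h2 : M ≤ κ * A := by rw [div_le_iff₀ hκ] at h1; linarith
    have h3 : A ≤ A ^ 3 := by
      have hA2 : 1 ≤ A ^ 2 := by nlinarith
      calc A = A * 1 := (mul_one A).symm
        _ ≤ A * A ^ 2 := mul_le_mul_of_nonneg_left hA2 hA0.le
        _ = A ^ 3 := by ring
    nlinarith
  obtain ⟨hsupp, hTI, hE, hunb⟩ := stub_selfSimilarSwirl_pointwise A hA0.le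
  obtain ⟨M₁, hM₁⟩ := stub_selfSimilarSwirl_loadCeiling A hA0.le
  -- the witness field, named locally
  set F : ℝ → EuclideanSpace ℝ (Fin 3) → EuclideanSpace ℝ (Fin 3) :=
    (fun (t : ℝ) (x : EuclideanSpace ℝ (Fin 3)) => if t < 1 then
      (A * (1 - t)⁻¹ * expNegInvGlue (4 - ‖x‖ ^ 2 / (1 - t))) •
        (WithLp.toLp 2 ![-(x 1), x 0, 0] : EuclideanSpace ℝ (Fin 3)) else 0) with hF
  -- (1) joint smoothness on `(−∞, 1) × ℝ³`
  have hcd : ContDiffOn ℝ ∞ (Function.uncurry F) (Set.Iio 1 ×ˢ Set.univ) := by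
    have hφ : ContDiff ℝ ((⊤ : ℕ∞) : WithTop ℕ∞) (fun s : ℝ => expNegInvGlue (4 - s)) :=
      expNegInvGlue.contDiff.comp (contDiff_const.sub contDiff_id)
    have hg : ContDiffOn ℝ ((⊤ : ℕ∞) : WithTop ℕ∞) (fun t : ℝ => A * (1 - t)⁻¹) (Set.Iio 1) := by
      refine (contDiffOn_const.mul ((contDiffOn_const.sub contDiffOn_id).inv ?_))
      intro t ht
      have : t < 1 := ht
      exact (sub_pos.2 this).ne'
    have hh : ContDiffOn ℝ ((⊤ : ℕ∞) : WithTop ℕ∞) (fun t : ℝ => (1 - t)) (Set.Iio 1) :=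
      (contDiffOn_const.sub contDiffOn_id)
    have hh0 : ∀ t ∈ Set.Iio (1 : ℝ), (1 - t) ≠ 0 := by
      intro t ht
      have : t < 1 := ht
      linarith
    have h := kinWitness_contDiffOn_swirlField (fun s : ℝ => expNegInvGlue (4 - s)) hφ
      (fun t : ℝ => A * (1 - t)⁻¹) (fun t : ℝ => (1 - t)) (Set.Iio 1) isOpen_Iio hg hh hh0
    refine h.congr ?_
    rintro ⟨t, x⟩ hp
    have ht : t < 1 := (Set.mem_prod.1 hp).1
    simp only [hF, Function.uncurry_apply_pair, if_pos ht]
  -- (2) spatial support: on `(−1/2, 1) × ℝ³` the field vanishes where `‖x‖ ≥ 3`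
  have hvan : ∀ p ∈ Set.Ioo (-(1/2 : ℝ)) 1 ×ˢ (Set.univ : Set (EuclideanSpace ℝ (Fin 3))),
      (3 : ℝ) ≤ ‖p.2‖ → Function.uncurry F p = 0 := by
    rintro ⟨t, x⟩ hp h3
    obtain ⟨ht1, ht2⟩ : -(1/2 : ℝ) < t ∧ t < 1 := (Set.mem_prod.1 hp).1
    have hs : 0 < 1 - t := by linarith
    -- the core radius `2 √(1 - t)` is below `3`
    have hρ : Real.sqrt (1 - t) ≤ 3 / 2 := by
      rw [Real.sqrt_le_left (by norm_num)]
      nlinarith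
    have hx : 2 * Real.sqrt (1 - t) ≤ ‖x‖ := by linarith
    exact hsupp t x ht2 hx
  -- (3) window regularity: smooth with all derivatives bounded on every `[a,b] ⊂ [0,1)`
  have hwin : ∀ a b : ℝ, 0 ≤ a → a < b → b < 1 →
      IsSmoothSpaceTimeOn (Set.Icc a b) F ∧ ∀ n : ℕ, ∃ C : ℝ, ∀ t ∈ Set.Icc a b,
        ∀ x : EuclideanSpace ℝ (Fin 3),
        ‖iteratedFDerivWithin ℝ n (Function.uncurry F) (Set.Icc a b ×ˢ Set.univ) (t, x)‖ ≤ C := by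
    intro a b ha hab hb
    have hU : IsOpen (Set.Ioo (-(1/2 : ℝ)) 1 ×ˢ (Set.univ : Set (EuclideanSpace ℝ (Fin 3)))) :=
      isOpen_Ioo.prod isOpen_univ
    have hsub : Set.Icc a b ×ˢ (Set.univ : Set (EuclideanSpace ℝ (Fin 3))) ⊆
        Set.Ioo (-(1/2 : ℝ)) 1 ×ˢ Set.univ :=
      Set.prod_mono (fun t ht => ⟨by linarith [ht.1], lt_of_le_of_lt ht.2 hb⟩) Subset.rfl
    have hcd' : ContDiffOn ℝ ((⊤ : ℕ∞) : WithTop ℕ∞) (Function.uncurry F)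
        (Set.Ioo (-(1/2 : ℝ)) 1 ×ˢ (Set.univ : Set (EuclideanSpace ℝ (Fin 3)))) :=
      hcd.mono (Set.prod_mono (fun t ht => ht.2) Subset.rfl)
    exact kinWitness_windowBounds_of_spatialSupport F _ a b 3 hab hU hsub hcd' hvan
  -- (4) coherence at EVERY scale: the field is tangential to the spheres about `0`
  have htan : ∀ (t : ℝ) (x : EuclideanSpace ℝ (Fin 3)), inner ℝ (F t x) x = 0 := by
    intro t x
    by_cases ht : t < 1
    · simp only [hF, if_pos ht, inner_smul_left]
      have h0 : inner ℝ (WithLp.toLp 2 ![-(x 1), x 0, 0] : EuclideanSpace ℝ (Fin 3)) x = 0 := by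
        rw [EuclideanSpace.inner_eq_star_dotProduct]
        simp [Fin.sum_univ_three, dotProduct]
        ring
      rw [h0, mul_zero]
    · simp only [hF, if_neg ht, inner_zero_left]
  have hcoh : ∀ r : ℝ, 0 < r → ¬ DissipatesAtScale F 1 0 r (min δ₁ (1/2)) := fun r hr =>
    hSW F 1 r hr (fun t _ x => htan t x) _ (le_min hδ₁.le (by norm_num)) (min_le_left _ _)
  -- (5) every slice is divergence free
  have hdiv : ∀ t : ℝ, VectorCalculus.IsDivFree (F t) := by
    intro t
    by_cases ht : t < 1
    · have hφ : ContDiff ℝ 1 (fun s : ℝ => expNegInvGlue (4 - s / (1 - t))) :=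
        expNegInvGlue.contDiff.comp (contDiff_const.sub (contDiff_id.div_const _))
      have h := kinWitness_isDivFree_swirlField _ hφ (A * (1 - t)⁻¹)
      have hfun : F t = fun x : EuclideanSpace ℝ (Fin 3) =>
          ((A * (1 - t)⁻¹) * expNegInvGlue (4 - ‖x‖ ^ 2 / (1 - t))) •
            (WithLp.toLp 2 ![-(x 1), x 0, 0] : EuclideanSpace ℝ (Fin 3)) := by
        funext x
        simp only [hF, if_pos ht]
      rw [hfun]
      exact h
    · have hfun : F t = fun _ : EuclideanSpace ℝ (Fin 3) => (0 : EuclideanSpace ℝ (Fin 3)) := by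
        funext x
        simp only [hF, if_neg ht]
      rw [hfun]
      intro x
      simp [VectorCalculus.divergence]
  -- assembly
  refine ⟨F, hcd.mono (Set.prod_mono (fun _ ht => ht.2) Subset.rfl), hdiv, hE,
    ⟨2 * A, fun t ht x => hTI t x ht⟩, ⟨M₁, hM₁⟩, fun r hr => ?_, hcoh, hunb hA0⟩
  exact (ENNReal.ofReal_le_ofReal hκA).trans (hfloor A hA0.le r hr)

/-- **Stub A is false without the momentum equation** (registered sub-goal). The statement of the registered
stub `stub_coherentTypeIExclusion` with its Navier–Stokes class hypotheses (`IsClassicalNSSolutionOn (Ico 0 T) 1 0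
u p`, `IsLerayHopfOn T 1 0 (u 0) u`, `HasRapidSpatialDecay (u 0)`) replaced by the KINEMATIC class — smooth
space–time field on `[0,T) × ℝ³`, divergence free, uniformly bounded finite energy, `L∞` Type-I(K) for some `K`
— is false: given the purported threshold `M = M(δ)`, the member of `coherentTypeI_kinematicWitness` for that `M`
satisfies the ceiling and the recurrence hypotheses at `(1, 0)` but is unbounded there. Hence incompressibility,
the energy class, a Type-I rate (in `L∞` and in `C`) and smoothness before `T` do not exclude recurrent — indeed
cofinal — coherent `M`-loaded scales at a blow-up point, for any `M`; a proof of A must use the Navier–Stokes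
dynamics (in tree: A ⇐ S1, A ⇐ `¬ TypeISingularityExists`). -/
theorem stub_coherentTypeIExclusion_false_without_momentum :
    ¬ (∀ δ : ℝ, 0 < δ → δ < 1 → ∃ M : ℝ, ∀ T : ℝ, 0 < T →
      ∀ (u : ℝ → EuclideanSpace ℝ (Fin 3) → EuclideanSpace ℝ (Fin 3)),
      Literature.Analysis.FluidPDE.IsSmoothSpaceTimeOn (Set.Ico 0 T) u →
      (∀ t ∈ Set.Ico 0 T, Literature.Analysis.FluidPDE.VectorCalculus.IsDivFree (u t)) →
      (∃ E₀ : ℝ, ∀ t ∈ Set.Ico 0 T,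
        MeasureTheory.MemLp (u t) 2 MeasureTheory.volume ∧ ∫ x, ‖u t x‖ ^ 2 ≤ E₀) →
      (∃ K : ℝ, ∀ t ∈ Set.Ico 0 T, ∀ x : EuclideanSpace ℝ (Fin 3), Real.sqrt (T - t) * ‖u t x‖ ≤ K) →
      ∀ x₀ : EuclideanSpace ℝ (Fin 3),
      (∃ M₁ r₁ : ℝ, 0 < r₁ ∧ ∀ r ∈ Set.Ioo 0 r₁,
          Literature.Analysis.FluidPDE.cknC r ((T, x₀) : ℝ × EuclideanSpace ℝ (Fin 3)) u ≤
            ENNReal.ofReal M₁) →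
      (∀ r₀ : ℝ, 0 < r₀ → ∃ r ∈ Set.Ioo 0 r₀,
          ENNReal.ofReal M ≤
            Literature.Analysis.FluidPDE.cknC r ((T, x₀) : ℝ × EuclideanSpace ℝ (Fin 3)) u ∧
          ¬ Literature.Analysis.FluidPDE.DissipatesAtScale u T x₀ r δ) →
      ∃ ρ : ℝ, 0 < ρ ∧ ∃ M' : ℝ, ∀ t ∈ Set.Ioo (T - ρ ^ 2) T, ∀ x ∈ Metric.ball x₀ ρ,
        ‖u t x‖ ≤ M') := by
  intro h
  obtain ⟨δ, hδ, hδ1, hw⟩ := coherentTypeI_kinematicWitness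
  obtain ⟨M, hM⟩ := h δ hδ hδ1
  obtain ⟨u, hsm, hdiv, hE, hTI, hceil, hload, hcoh, hunb⟩ := hw M
  obtain ⟨E₀, hE₀⟩ := hE
  obtain ⟨K, hK⟩ := hTI
  obtain ⟨M₁, hM₁⟩ := hceil
  obtain ⟨ρ, hρ, M', hbdd⟩ := hM 1 one_pos u hsm (fun t _ => hdiv t) ⟨E₀, fun t ht => hE₀ t ht.1⟩
    ⟨K, fun t ht x => hK t ht.2 x⟩ 0 ⟨M₁, 1, one_pos, fun r hr => hM₁ r hr.1⟩
    (fun r₀ hr₀ => ⟨r₀ / 2, ⟨by positivity, by linarith⟩, hload _ (by positivity), hcoh _ (by positivity)⟩)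
  obtain ⟨t, ht, x, hx, hlt⟩ := hunb ρ hρ M'
  exact absurd (hbdd t ht x hx) (not_le.2 hlt)

end Summit.NavierStokesRegularity.NavierStokesRegularity.Theorems

end
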